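import Literature.MathematicalPhysics.QuantumLattice.HubbardDressedClusterNode
import Literature.InformationTheory.Entropy.VonNeumannEntropyConcavity
import Mathlib.Topology.Instances.Matrix
import Mathlib.Topology.Algebra.Module.FiniteDimension
import HarnessLib

/-!
# Regularisation of the C3 claim node: a bound valid for all positive-definite witnesses extends to the
# positive-semidefinite floor node (certificate C3 of the `T > 0` Hubbard family)

Topic `Literature/MathematicalPhysics/QuantumLattice` (namespace = path; family `hubbard`). The C3 claim nodes
(`SeamDressed.Node` / `SeamDressed.FloorNode`, `HubbardDressedClusterNode.lean`) transcribe hubbard-thermal-eng-2's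
seam-dressed cluster certificates faithfully: the box state `σ = ⊕_s q_s ρ_s` is supported on the lowest levels of a
few particle-number sectors, hence only POSITIVE SEMIDEFINITE. The kernel pressure-floor theorem of the sequel
(`HubbardDressedClusterPressureFloor.lean`, hubbard-thermal-p2: `(S(σ) − β·E_box(σ, W))/(ab) ≤ pressureTT' β t t' U n`)
obtains the entropy of the torus trial state from the modular Hamiltonian `−Σ log σ` and therefore assumes `σ ≻ 0`.
This file closes the gap once and for all, independently of the exact shape of that theorem:

* §1 `exists_posDef_commute_totalNumber_density` — on any finite orbital set there is a POSITIVE DEFINITE,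
  particle-number-commuting density matrix of any prescribed density `0 < n < 2` per site: the Bernoulli product
  state `τ = diag(p^{|s|} (1−p)^{2|Λ|−|s|})`, `p = n/2` (the infinite-temperature grand-canonical state at filling `n`);
  the binomial identities `Σ_s p^{|s|}(1−p)^{M−|s|} = 1`, `Σ_s p^{|s|}(1−p)^{M−|s|}|s| = Mp`
  (`sum_powerset_pow_mul_pow_mul_card`).
* §2 continuity of the dressed functional in the box state: `continuous_boxProd` (a `boxProd` of continuously
  varying even factors is continuous), `SeamDressed.continuous_localMarginal / continuous_locE / continuous_boxEnergy`
  (the part marginals are linear in `σ`, the functional is a finite sum of traces of finite products).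
* §3 **`SeamDressed.FloorNode.le_of_posDef_bound`**: if `FloorNode t t' U a b n β W0` holds (`0 < n < 2`) and a
  number `P` bounds `S(σ') − β·E_box(σ', W) ≤ P·ab` for EVERY positive-definite witness `σ'` carrying the node's gate data
  (`G ⊆ gateRange`, separated, `u` unitary and number-conserving) with `tr σ' = 1`, `[σ', N] = 0`, `Re tr(σ'N) = n·ab`,
  then `W0 ≤ P`. Proof: along the segment `σ_δ = (1−δ)σ + δτ` (`δ ∈ (0,1]`: positive definite, same trace, same density,
  number-commuting) concavity of the von Neumann entropy gives `S(σ_δ) ≥ (1−δ)S(σ) + δS(τ) ≥ (1−δ)S(σ)`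
  (`vonNeumannEntropy_convexComb_two_ge`, `vonNeumannEntropy_nonneg`), so `(1−δ)S(σ) − βE_box(σ_δ) ≤ P·ab`; the left side is
  continuous in `δ` (§2) and tends to `S(σ) − βE_box(σ) ≥ W0·ab` as `δ → 0⁺`.

USE (hubbard-thermal cell files): with `P := pressureTT' β 1 t' 8 (7/8)` and the sequel's theorem supplying the hypothesis,
every landed node `cert_c3_…` (`Certificates/HubbardSquare_n7o8_thermal_C3nodes_3x3plaq.lean`) yields `W0 ≤ pressureTT' …`,
the `hW` input of the input-affine plugs (`…_inputAffine_of_pressureFloor`). Pure theorems; no definition, no named fact.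
[cite: Israel1979, Lemma II.3.1] [cite: NielsenChuang2010, Theorem 11.10 eq. (11.87) p.517] [cite: KlieschEtAl2014, §II]

## Tree / Mathlib search

REUSED: `SeamDressed.FloorNode`, `SeamDressed.boxEnergy/locE/localMarginal/localDressing` (`HubbardDressedClusterNode`,
`HubbardDressedClusterEnergyFunctional`), `boxProd`, `boxProd_empty`, `boxProd_insert` (`FermionBoxProductMarginals`),
`fermionPartialTrace` (a `LinearMap`), `fermionEmbed` (an `AlgHom`), `parityAut_eq_self_of_commute_totalNumber`,
`totalNumberOp_eq_totalNumber`, `totalNumberOp_eq_diagonal`, `card_rectWindow`,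
`Literature.InformationTheory.Entropy.vonNeumannEntropy_convexComb_two_ge`, `vonNeumannEntropy_nonneg`;
Mathlib `Matrix.posDef_diagonal_iff`, `Matrix.PosDef.posSemidef_add`, `Matrix.PosDef.smul`, `Matrix.PosSemidef.smul`,
`Finset.sum_pow_mul_eq_add_pow`, `Finset.sum_powerset_insert`, `LinearMap.continuous_of_finiteDimensional`,
`Continuous.matrix_trace`, `le_of_tendsto`, `Ioc_mem_nhdsGT`.
`lean search 'le_of_posDef_bound|exists_posDef_commute_totalNumber|continuous_boxProd|continuous_boxEnergy'`: nothing (2026-08-27).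

## References

* R. B. Israel, *Convexity in the Theory of Lattice Gases* (1979), Lemma II.3.1 (Gibbs variational bound for trial states).
  [cite: Israel1979, Lemma II.3.1]
* M. A. Nielsen, I. L. Chuang, *Quantum Computation and Quantum Information* (2010), Theorem 11.10 (concavity of the entropy).
  [cite: NielsenChuang2010, Theorem 11.10 eq. (11.87) p.517]
* M. Kliesch, C. Gogolin, M. J. Kastoryano, A. Riera, J. Eisert, Phys. Rev. X 4 (2014) 031019, §II. [cite: KlieschEtAl2014, §II]
-/

noncomputable section

namespace Literature.MathematicalPhysics.QuantumLattice

open Matrix Finset HubbardWave0 Literature.Probability.LatticeModels AndersonCluster Literature.InformationTheory.Entropy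
  Filter Topology
open scoped ComplexOrder BigOperators

/-! ### §1. The Bernoulli product density: a positive-definite number-commuting state of prescribed density -/

section Bernoulli

/-- **Mean of the binomial distribution over subsets**: `Σ_{T ⊆ S} p^{|T|} (1−p)^{|S|−|T|} |T| = |S|·p`.
[cite: NielsenChuang2010, Theorem 11.10 eq. (11.87) p.517] -/
theorem sum_powerset_pow_mul_pow_mul_card {ι : Type*} [DecidableEq ι] (p : ℝ) (S : Finset ι) :
    ∑ T ∈ S.powerset, p ^ T.card * (1 - p) ^ (S.card - T.card) * (T.card : ℝ) = S.card * p := by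
  induction S using Finset.induction_on with
  | empty => simp
  | insert i S hi ih =>
    rw [Finset.sum_powerset_insert hi, Finset.card_insert_of_notMem hi]
    have h1 : ∑ T ∈ S.powerset, p ^ T.card * (1 - p) ^ (S.card + 1 - T.card) * (T.card : ℝ)
        = (1 - p) * ∑ T ∈ S.powerset, p ^ T.card * (1 - p) ^ (S.card - T.card) * (T.card : ℝ) := by
      rw [Finset.mul_sum]
      refine Finset.sum_congr rfl fun T hT => ?_
      have hTS : T.card ≤ S.card := Finset.card_le_card (Finset.mem_powerset.1 hT)
      rw [show S.card + 1 - T.card = (S.card - T.card) + 1 by omega, pow_succ]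
      ring
    have h2 : ∑ T ∈ S.powerset, p ^ (insert i T).card * (1 - p) ^ (S.card + 1 - (insert i T).card) *
          ((insert i T).card : ℝ)
        = p * ∑ T ∈ S.powerset, p ^ T.card * (1 - p) ^ (S.card - T.card) * (T.card : ℝ)
          + p * ∑ T ∈ S.powerset, p ^ T.card * (1 - p) ^ (S.card - T.card) := by
      rw [Finset.mul_sum, Finset.mul_sum, ← Finset.sum_add_distrib]
      refine Finset.sum_congr rfl fun T hT => ?_
      have hTS : T ⊆ S := Finset.mem_powerset.1 hT
      have hiT : i ∉ T := fun h => hi (hTS h)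
      have hTc : T.card ≤ S.card := Finset.card_le_card hTS
      rw [Finset.card_insert_of_notMem hiT, show S.card + 1 - (T.card + 1) = S.card - T.card by omega, pow_succ]
      push_cast
      ring
    rw [h1, h2, ih, Finset.sum_pow_mul_eq_add_pow, show p + (1 - p) = 1 by ring, one_pow]
    push_cast
    ring

variable (Λ : Type*) [LinearOrder Λ] [Fintype Λ]

/-- **The Bernoulli product density.** On the Fock space over the orbitals of a finite site set `Λ` there is, for
every `0 < n < 2`, a POSITIVE DEFINITE density matrix commuting with the particle number and of mean particle number
`n·|Λ|`: `τ = diag_s p^{|s|}(1−p)^{2|Λ|−|s|}` with `p = n/2` (each orbital independently occupied with probability `p`;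
the `β = 0` grand-canonical state at filling `n`). [cite: Israel1979, Lemma II.3.1] -/
theorem exists_posDef_commute_totalNumber_density {n : ℝ} (hn0 : 0 < n) (hn2 : n < 2) :
    ∃ τ : Matrix (Finset (Orb Λ)) (Finset (Orb Λ)) ℂ,
      τ.PosDef ∧ τ.trace = 1 ∧ Commute (totalNumber : Matrix (Finset (Orb Λ)) (Finset (Orb Λ)) ℂ) τ ∧
        (τ * (totalNumber : Matrix (Finset (Orb Λ)) (Finset (Orb Λ)) ℂ)).trace.re = n * Fintype.card Λ := by
  classical
  obtain ⟨p, hp⟩ : ∃ p : ℝ, p = n / 2 := ⟨_, rfl⟩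
  have hp0 : 0 < p := by rw [hp]; positivity
  have hq0 : 0 < 1 - p := by rw [hp]; linarith
  obtain ⟨w, hw⟩ : ∃ w : Finset (Orb Λ) → ℝ,
      w = fun s => p ^ s.card * (1 - p) ^ (Fintype.card (Orb Λ) - s.card) := ⟨_, rfl⟩
  have hwpos : ∀ s, 0 < w s := fun s => by rw [hw]; exact mul_pos (pow_pos hp0 _) (pow_pos hq0 _)
  have hN : (totalNumber : Matrix (Finset (Orb Λ)) (Finset (Orb Λ)) ℂ) = diagonal fun s => (s.card : ℂ) := by
    rw [← totalNumberOp_eq_totalNumber, totalNumberOp_eq_diagonal]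
  refine ⟨diagonal fun s => ((w s : ℝ) : ℂ), ?_, ?_, ?_, ?_⟩
  · rw [Matrix.posDef_diagonal_iff]
    exact fun s => Complex.zero_lt_real.2 (hwpos s)
  · rw [trace_diagonal]
    have hsum : ∑ s : Finset (Orb Λ), w s = 1 := by
      have h := Finset.sum_pow_mul_eq_add_pow p (1 - p) (Finset.univ : Finset (Orb Λ))
      rw [Finset.powerset_univ, Finset.card_univ, show p + (1 - p) = 1 by ring, one_pow] at h
      rw [hw]
      exact h
    exact_mod_cast congrArg (fun r : ℝ => (r : ℂ)) hsum
  · rw [hN, Commute, SemiconjBy, diagonal_mul_diagonal, diagonal_mul_diagonal]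
    congr 1
    ext s
    exact mul_comm _ _
  · rw [hN, diagonal_mul_diagonal, trace_diagonal]
    have hre : (∑ s : Finset (Orb Λ), ((w s : ℝ) : ℂ) * (s.card : ℂ)) =
        ((∑ s : Finset (Orb Λ), w s * (s.card : ℝ) : ℝ) : ℂ) := by
      push_cast
      rfl
    rw [hre, Complex.ofReal_re]
    have h := sum_powerset_pow_mul_pow_mul_card p (Finset.univ : Finset (Orb Λ))
    rw [Finset.powerset_univ, Finset.card_univ] at h
    have hw' : ∀ s : Finset (Orb Λ), w s * (s.card : ℝ) =
        p ^ s.card * (1 - p) ^ (Fintype.card (Orb Λ) - s.card) * (s.card : ℝ) := fun s => by rw [hw]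
    simp_rw [hw']
    rw [h, card_orb (Λ := Λ), hp]
    push_cast
    ring

end Bernoulli

/-! ### §2. Continuity of box products and of the dressed functional in the box state -/

section Continuity

variable {Λ : Type*} [LinearOrder Λ] [Fintype Λ]

/-- The CAR embedding `Γ_φ` is continuous (a linear map of finite-dimensional spaces).
[cite: ArakiMoriya2003, §4.1 Def. 4.1 (2) and Def. 4.3] -/
theorem continuous_fermionEmbed {Λ' : Type*} [LinearOrder Λ'] [Fintype Λ'] (ψ : Λ ↪ Λ') :
    Continuous (fermionEmbed ψ :
      Matrix (Finset (Orb Λ)) (Finset (Orb Λ)) ℂ → Matrix (Finset (Orb Λ')) (Finset (Orb Λ')) ℂ) :=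
  (fermionEmbed ψ).toLinearMap.continuous_of_finiteDimensional

/-- The fermionic partial trace is continuous (a linear map of finite-dimensional spaces).
[cite: NielsenChuang2010, §2.4.3 Box 2.6 eq. (2.180)] -/
theorem continuous_fermionPartialTrace {Λ' : Type*} [LinearOrder Λ'] [Fintype Λ'] (ψ : Λ ↪ Λ') :
    Continuous (fermionPartialTrace ψ :
      Matrix (Finset (Orb Λ')) (Finset (Orb Λ')) ℂ → Matrix (Finset (Orb Λ)) (Finset (Orb Λ)) ℂ) :=
  (fermionPartialTrace ψ).continuous_of_finiteDimensional

variable {K : Type*} {Λ₀ : K → Type*} [∀ k, LinearOrder (Λ₀ k)] [∀ k, Fintype (Λ₀ k)] {φ : ∀ k, Λ₀ k ↪ Λ}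
  (hφ : ∀ k j, k ≠ j → Disjoint ((Finset.univ : Finset (Λ₀ k)).map (φ k)) ((Finset.univ : Finset (Λ₀ j)).map (φ j)))

/-- **A box product of continuously varying even factors is continuous** (induction on the boxes: the empty
product is `𝟙`, and `Π_{insert k S} = Γ_k a_k · Π_S`). [cite: ArakiMoriya2003, §11.1 Theorem 11.2] -/
theorem continuous_boxProd {X : Type*} [TopologicalSpace X]
    (f : X → ∀ k, Matrix (Finset (Orb (Λ₀ k))) (Finset (Orb (Λ₀ k))) ℂ)
    (hf : ∀ x k, parityAut (f x k) = f x k) (hcont : ∀ k, Continuous fun x => f x k) (S : Finset K) :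
    Continuous fun x => boxProd hφ (f x) (hf x) S := by
  classical
  induction S using Finset.induction_on with
  | empty =>
    have h : (fun x => boxProd hφ (f x) (hf x) ∅) = fun _ => 1 := funext fun x => boxProd_empty hφ (hf x)
    rw [h]
    exact continuous_const
  | insert k S hk ih =>
    have h : (fun x => boxProd hφ (f x) (hf x) (insert k S)) =
        fun x => fermionEmbed (φ k) (f x k) * boxProd hφ (f x) (hf x) S :=
      funext fun x => boxProd_insert hφ (hf x) hk
    rw [h]
    exact ((continuous_fermionEmbed (φ k)).comp (hcont k)).mul ih

end Continuity

namespace SeamDressed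

section Functional

variable (a b : ℕ) [NeZero a] [NeZero b] {m : ℕ} (G : Fin m → Finset (Site 2))
  (hsep : ∀ g g', ∀ x ∈ G g, ∀ x' ∈ G g', ((a : ℤ) ∣ x' 0 - x 0) → ((b : ℤ) ∣ x' 1 - x 1) → g = g' ∧ x = x')
  (u : ∀ g, FermionOp (G g)) (hu : ∀ g, parityAut (u g) = u g)

/-- The dressed box energy depends on the box state only (not on the evenness witness): equal states give equal
energies. [cite: KlieschEtAl2014, §II] -/
theorem boxEnergy_congr {σ σ' : FermionOp (rectWindow a b)} (h : σ = σ') (hσ : parityAut σ = σ)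
    (hσ' : parityAut σ' = σ') (t t' U : ℝ) :
    boxEnergy a b G hsep u hu σ hσ t t' U = boxEnergy a b G hsep u hu σ' hσ' t t' U := by
  subst h
  rfl

/-- **The product of part marginals is continuous in the box state** (each part marginal is linear in `σ`).
[cite: ArakiMoriya2003, §11.1 Theorem 11.2] -/
theorem continuous_localMarginal {X : Type*} [TopologicalSpace X] {σ : X → FermionOp (rectWindow a b)}
    (hσ : ∀ x, parityAut (σ x) = σ x) (hcont : Continuous σ) (S : Finset (Site 2)) :
    Continuous fun x => localMarginal a b G (σ x) (hσ x) S := by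
  unfold localMarginal
  exact continuous_boxProd (disjoint_partLeg a b G S)
    (fun x (w : ↥(boxOffsets a b G S)) => fermionPartialTrace (partChart a b G S w.1) (σ x))
    (fun x _ => parityAut_fermionPartialTrace_of_even _ (hσ x))
    (fun w => (continuous_fermionPartialTrace (partChart a b G S w.1)).comp hcont) Finset.univ

/-- **The dressed local expectation is continuous in the box state.** [cite: KlieschEtAl2014, §II] -/
theorem continuous_locE {X : Type*} [TopologicalSpace X] {σ : X → FermionOp (rectWindow a b)}
    (hσ : ∀ x, parityAut (σ x) = σ x) (hcont : Continuous σ) (S : Finset (Site 2)) (h : FermionOp S) :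
    Continuous fun x => locE a b G hsep u hu (σ x) (hσ x) S h := by
  unfold locE
  exact Complex.continuous_re.comp
    (((continuous_localMarginal a b G hσ hcont S).mul continuous_const).matrix_trace)

/-- **The dressed box energy is continuous in the box state** (a finite sum of dressed local expectations).
[cite: KlieschEtAl2014, §II] -/
theorem continuous_boxEnergy {X : Type*} [TopologicalSpace X] {σ : X → FermionOp (rectWindow a b)}
    (hσ : ∀ x, parityAut (σ x) = σ x) (hcont : Continuous σ) (t t' U : ℝ) :
    Continuous fun x => boxEnergy a b G hsep u hu (σ x) (hσ x) t t' U := by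
  unfold boxEnergy
  refine continuous_finsetSum _ fun y _ => ?_
  have hc := fun (S : Finset (Site 2)) (h : FermionOp S) => continuous_locE a b G hsep u hu hσ hcont S h
  exact ((continuous_const.mul (hc _ _)).sub (continuous_const.mul ((hc _ _).add (hc _ _)))).sub
    (continuous_const.mul ((hc _ _).add (hc _ _)))

end Functional

/-! ### §3. The regularisation theorem -/

/-- `|PolySite A| = |A|`. [folklore] -/
private theorem card_polySite' {d : ℕ} (A : Finset (Site d)) : Fintype.card (PolySite A) = A.card := by
  unfold PolySite lexSites
  rw [Fintype.card_coe, Finset.card_map]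

/-- **Regularisation of the C3 floor node.** Let `FloorNode t t' U a b n β W0` hold with `0 < n < 2` (any real `β`), and
let `P` satisfy `S(σ') − β·E_box(σ', W) ≤ P·(ab)` for every POSITIVE-DEFINITE box state `σ'` (`tr σ' = 1`,
`[σ', N] = 0`, `Re tr(σ'N) = n·ab`) dressed by the node's gate data (`G g ⊆ gateRange a b`, separated modulo the box
lattice, `u g` unitary and particle-number conserving). Then `W0 ≤ P`. (Proof: regularise the node's witness `σ ⪰ 0`
by the Bernoulli product density `τ ≻ 0` of the same density, `σ_δ = (1−δ)σ + δτ`; concavity of `S`, continuity of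
`E_box` in `δ`, and `δ → 0⁺`.) With `P = pressureTT' β t t' U n` (sequel) this turns every landed C3 node into the
pressure floor `W0 ≤ pressureTT' β t t' U n`. [cite: Israel1979, Lemma II.3.1]
[cite: NielsenChuang2010, Theorem 11.10 eq. (11.87) p.517] -/
theorem FloorNode.le_of_posDef_bound {t t' U : ℝ} {a b : ℕ} [NeZero a] [NeZero b] {n β W0 P : ℝ}
    (h : FloorNode t t' U a b n β W0) (hn0 : 0 < n) (hn2 : n < 2)
    (hP : ∀ (m : ℕ) (G : Fin m → Finset (Site 2))
      (hsep : ∀ g g', ∀ x ∈ G g, ∀ x' ∈ G g', ((a : ℤ) ∣ x' 0 - x 0) → ((b : ℤ) ∣ x' 1 - x 1) → g = g' ∧ x = x')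
      (u : ∀ g, FermionOp (G g)) (huN : ∀ g, Commute (totalNumber : FermionOp (G g)) (u g))
      (σ : FermionOp (rectWindow a b)) (hσN : Commute (totalNumber : FermionOp (rectWindow a b)) σ),
      (∀ g, G g ⊆ gateRange a b) → (∀ g, (u g)ᴴ * u g = 1) → σ.PosDef → σ.trace = 1 →
      (σ * (totalNumber : FermionOp (rectWindow a b))).trace.re = n * (a * b) →
      vonNeumannEntropy σ -
          β * boxEnergy a b G hsep u (fun g => parityAut_eq_self_of_commute_totalNumber (huN g)) σ
            (parityAut_eq_self_of_commute_totalNumber hσN) t t' U ≤ P * (a * b)) :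
    W0 ≤ P := by
  obtain ⟨m, G, hsep, u, huN, σ, hσN, hG, huU, hσ, hσtr, hσn, hW⟩ := h
  -- the regulariser: a positive-definite number-commuting density of the same density
  obtain ⟨τ, hτpd, hτtr, hτN, hτn⟩ :=
    exists_posDef_commute_totalNumber_density (PolySite (rectWindow a b)) hn0 hn2
  have hcard : (Fintype.card (PolySite (rectWindow a b)) : ℝ) = a * b := by
    rw [card_polySite', card_rectWindow]
    push_cast
    rfl
  rw [hcard] at hτn
  -- the segment `σ_δ = (1 − δ) σ + δ τ`
  obtain ⟨seg, hseg⟩ : ∃ seg : ℝ → FermionOp (rectWindow a b),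
      seg = fun δ => ((1 - δ : ℝ) : ℂ) • σ + ((δ : ℝ) : ℂ) • τ := ⟨_, rfl⟩
  have hsegN : ∀ δ, Commute (totalNumber : FermionOp (rectWindow a b)) (seg δ) := fun δ => by
    rw [hseg]
    exact (hσN.smul_right _).add_right (hτN.smul_right _)
  have hsegc : Continuous seg := by
    rw [hseg]
    exact ((Complex.continuous_ofReal.comp (continuous_const.sub continuous_id)).smul continuous_const).add
      ((Complex.continuous_ofReal.comp continuous_id).smul continuous_const)
  have hseg0 : seg 0 = σ := by
    rw [hseg]
    simp
  -- the energy along the segment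
  obtain ⟨E, hE⟩ : ∃ E : ℝ → ℝ, E = fun δ => boxEnergy a b G hsep u
      (fun g => parityAut_eq_self_of_commute_totalNumber (huN g)) (seg δ)
      (parityAut_eq_self_of_commute_totalNumber (hsegN δ)) t t' U := ⟨_, rfl⟩
  have hEc : Continuous E := by
    rw [hE]
    exact continuous_boxEnergy a b G hsep u (fun g => parityAut_eq_self_of_commute_totalNumber (huN g))
      (fun δ => parityAut_eq_self_of_commute_totalNumber (hsegN δ)) hsegc t t' U
  have hE0 : E 0 = boxEnergy a b G hsep u (fun g => parityAut_eq_self_of_commute_totalNumber (huN g)) σ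
      (parityAut_eq_self_of_commute_totalNumber hσN) t t' U := by
    rw [hE]
    exact boxEnergy_congr a b G hsep u _ hseg0 _ _ t t' U
  -- the bound along the segment, `δ ∈ (0, 1]`
  have hPδ : ∀ δ, 0 < δ → δ ≤ 1 → (1 - δ) * vonNeumannEntropy σ - β * E δ ≤ P * (a * b) := by
    intro δ hδ0 hδ1
    have hpd : (seg δ).PosDef := by
      rw [hseg]
      exact Matrix.PosDef.posSemidef_add (hσ.smul (Complex.zero_le_real.2 (by linarith)))
        (hτpd.smul (Complex.zero_lt_real.2 hδ0))
    have htr : (seg δ).trace = 1 := by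
      rw [hseg]
      simp only [trace_add, trace_smul, smul_eq_mul, hσtr, hτtr, mul_one]
      push_cast
      ring
    have hn' : (seg δ * (totalNumber : FermionOp (rectWindow a b))).trace.re = n * (a * b) := by
      rw [hseg]
      simp only [add_mul, smul_mul_assoc, trace_add, trace_smul, smul_eq_mul, Complex.add_re,
        Complex.re_ofReal_mul]
      rw [hσn, hτn]
      ring
    have hS : (1 - δ) * vonNeumannEntropy σ ≤ vonNeumannEntropy (seg δ) := by
      have hc := vonNeumannEntropy_convexComb_two_ge hδ0.le hδ1 (ρ := σ) (τ := τ) ⟨hσ, hσtr⟩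
        ⟨hτpd.posSemidef, hτtr⟩
      have hτS : 0 ≤ δ * vonNeumannEntropy τ :=
        mul_nonneg hδ0.le (vonNeumannEntropy_nonneg hτpd.posSemidef hτtr)
      rw [hseg]
      linarith
    have key : vonNeumannEntropy (seg δ) - β * E δ ≤ P * (a * b) := by
      rw [hE]
      exact hP m G hsep u huN (seg δ) (hsegN δ) hG huU hpd htr hn'
    linarith
  -- `δ → 0⁺`
  have hlim : Tendsto (fun δ => (1 - δ) * vonNeumannEntropy σ - β * E δ) (𝓝[>] (0 : ℝ))
      (𝓝 ((1 - 0) * vonNeumannEntropy σ - β * E 0)) := by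
    have hc : Continuous fun δ : ℝ => (1 - δ) * vonNeumannEntropy σ - β * E δ :=
      ((continuous_const.sub continuous_id).mul continuous_const).sub (continuous_const.mul hEc)
    exact (hc.tendsto 0).mono_left nhdsWithin_le_nhds
  have hle : (1 - 0) * vonNeumannEntropy σ - β * E 0 ≤ P * (a * b) :=
    le_of_tendsto hlim (by
      filter_upwards [Ioc_mem_nhdsGT (zero_lt_one' ℝ)] with δ hδ using hPδ δ hδ.1 hδ.2)
  rw [sub_zero, one_mul, hE0] at hle
  have hab : (0 : ℝ) < a * b := by
    have ha : (0 : ℝ) < a := by exact_mod_cast Nat.pos_of_ne_zero (NeZero.ne a)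
    have hb : (0 : ℝ) < b := by exact_mod_cast Nat.pos_of_ne_zero (NeZero.ne b)
    exact mul_pos ha hb
  exact le_of_mul_le_mul_right (hW.trans hle) hab

end SeamDressed

end Literature.MathematicalPhysics.QuantumLattice

end
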